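import Mathlib
import HarnessLib
import Summits.RiemannHypothesis.RiemannHypothesis.Theorems.IntegerScrewTailSoundA

/-!
# Soundness of the tail checker, II: the cell test (+ preparations for the last cell)

`cellSums_sound`, `grossB_sound` and `cellCheck_sound`: `cellCheck E N₁ N_c N₂ = true` implies `D(N) < 0`
for every real `N ∈ [N₁, N₂]` (edges with `a < b ≤ 15`), via `dsum_taylor_bound`.  The wrapper `cellCheck`
routes its logarithms through the pattern-matched `logNat` so that the kernel never unfolds fixed-point
arithmetic on a symbolic natural.  Nothing here bears on the truth of RH.
-/

set_option autoImplicit false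
set_option linter.dupNamespace false

noncomputable section

open scoped Topology
open Real Filter Set

namespace Summit.RiemannHypothesis.RiemannHypothesis.Theorems.IntegerScrew.TopBlockNeg

open Literature.Analysis.ValidatedNumerics Literature.Analysis.ValidatedNumerics.Numerics
open Summit.RiemannHypothesis.RiemannHypothesis.Theorems.IntegerScrew
open Literature.NumberTheory.LFunctions
open Finset

/-- **Soundness of the per-edge point enclosures.** [folklore] -/
theorem edgePoint_sound {B logNcA logL : FI} {a b Nc : ℕ} {Δ : ℚ} {h0 h1d h2dd : FI}
    (hB : FI.mem zetaScrewSlope B) (hA : FI.mem (Real.log ((Nc : ℝ) - a)) logNcA)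
    (hL : FI.mem (Real.log ((b : ℝ) - a)) logL) (hab : a < b) (hb15 : b ≤ 15) (hNc : 128 ≤ Nc)
    (h : edgePoint B logNcA logL a b Nc Δ = some (h0, h1d, h2dd)) :
    FI.mem (edgeH a b Nc) h0 ∧ FI.mem (edgeH1 a b Nc * Δ) h1d ∧ FI.mem (edgeH2 a b Nc * Δ ^ 2) h2dd := by
  have hbN : b < Nc := by omega
  have hab' : (a : ℝ) < b := by exact_mod_cast hab
  have hbN' : (b : ℝ) < Nc := by exact_mod_cast hbN
  have hb15' : (b : ℝ) ≤ 15 := by exact_mod_cast hb15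
  have hNc' : (128 : ℝ) ≤ Nc := by exact_mod_cast hNc
  -- u and its brackets
  obtain ⟨ulo, uhi⟩ := uBr_spec hab hbN
  obtain ⟨hu0, _⟩ := edgeU_pos_lt hab (N := (Nc : ℝ)) (by linarith)
  obtain ⟨_, uhi2⟩ := edgeU_bounds hab hbN'
  have hu_half : edgeU a b Nc ≤ 1 / 2 := by
    have : ((b : ℝ) - a) / ((Nc : ℝ) - b) ≤ 1 / 2 := by
      rw [div_le_iff₀ (by linarith)]; linarith [(Nat.cast_nonneg a : (0:ℝ) ≤ a)]
    linarith
  unfold edgePoint at h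
  dsimp only at h
  split_ifs at h with hpos
  push Not at hpos
  split at h
  · exact absurd h (by simp)
  · rename_i LU hLU
    simp only [Option.some.injEq, Prod.mk.injEq] at h
    obtain ⟨rfl, rfl, rfl⟩ := h
    have hU : FI.mem (edgeU a b Nc) (FI.ofRatRat (uBr a b Nc).1 (uBr a b Nc).2) := FI.mem_ofRatRat ulo uhi
    have hlogu := mem_logUEncl hab hbN hA hL hU (x_le_edgeU hab hbN') hLU
    have hPsi := mem_psiEncl hB hU hlogu hu0 hu_half
    have hPsi1 := mem_psi1Encl hB hU hlogu hu0 (by linarith)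
    have hPsi2 := mem_psi2Encl hU ulo uhi hpos (by linarith)
    -- exact rational coefficients
    have hqa : ((Nc : ℚ) - a : ℚ) ≠ 0 := by
      have : (a : ℚ) < Nc := by exact_mod_cast (show a < Nc by omega)
      linarith
    have hqb : ((Nc : ℚ) - b : ℚ) ≠ 0 := by
      have : (b : ℚ) < Nc := by exact_mod_cast hbN
      linarith
    have eu1 : (((1 / ((Nc : ℚ) - a) - 1 / ((Nc : ℚ) - b)) : ℚ) : ℝ) = edgeU1 a b Nc := by
      unfold edgeU1; push_cast; ring
    have eu2 : (((-1 / ((Nc : ℚ) - a) ^ 2 + 1 / ((Nc : ℚ) - b) ^ 2) : ℚ) : ℝ) = edgeU2 a b Nc := by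
      unfold edgeU2; push_cast; ring
    refine ⟨?_, ?_, ?_⟩
    · -- h0
      have := FI.mem_mulInt hPsi (Nc : ℤ)
      unfold edgeH; convert this using 1; push_cast; ring
    · -- h1d
      have c1 := FI.mem_ofRat Δ
      have c2 := FI.mem_ofRat ((Nc : ℚ) * (1 / ((Nc : ℚ) - a) - 1 / ((Nc : ℚ) - b)) * Δ)
      have := FI.mem_add (FI.mem_mul hPsi c1) (FI.mem_mul hPsi1 c2)
      convert this using 1
      unfold edgeH1
      rw [← eu1]; push_cast; ring
    · -- h2dd
      have c1 := FI.mem_ofRat ((1 / ((Nc : ℚ) - a) - 1 / ((Nc : ℚ) - b)) * Δ ^ 2)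
      have c2 := FI.mem_ofRat ((Nc : ℚ) * (1 / ((Nc : ℚ) - a) - 1 / ((Nc : ℚ) - b)) ^ 2 * Δ ^ 2)
      have c3 := FI.mem_ofRat ((Nc : ℚ) * (-1 / ((Nc : ℚ) - a) ^ 2 + 1 / ((Nc : ℚ) - b) ^ 2) * Δ ^ 2)
      have := FI.mem_add (FI.mem_add (FI.mem_mulInt (FI.mem_mul hPsi1 c1) 2) (FI.mem_mul hPsi2 c2))
        (FI.mem_mul hPsi1 c3)
      convert this using 1
      unfold edgeH2
      rw [← eu1, ← eu2]; push_cast; ring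


/-- Soundness of `cellSums`: enclosures of `D(N_c)`, `D′(N_c)·Δ`, `D″(N_c)·Δ²`. [folklore] -/
theorem cellSums_sound {B logNc : FI} {Δ : ℚ} {Nc : ℕ} (hB : FI.mem zetaScrewSlope B)
    (hlogNc : FI.mem (Real.log Nc) logNc) (hNc : 128 ≤ Nc) :
    ∀ (E : List (ℕ × ℕ × ℤ)), (∀ t ∈ E, t.1 < t.2.1 ∧ t.2.1 ≤ 15) →
      ∀ {D0 D1 D2 : FI}, cellSums B Δ (logsAt logNc Nc) Nc E = some (D0, D1, D2) →
        FI.mem (dsum edgeH E Nc) D0 ∧ FI.mem (dsum edgeH1 E Nc * Δ) D1 ∧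
          FI.mem (dsum edgeH2 E Nc * Δ ^ 2) D2
  | [], _, D0, D1, D2, h => by
      simp only [cellSums, Option.some.injEq, Prod.mk.injEq] at h
      obtain ⟨rfl, rfl, rfl⟩ := h
      simp only [dsum, List.map_nil, List.sum_nil, zero_mul]
      exact ⟨FI.mem_zero, FI.mem_zero, FI.mem_zero⟩
  | (a, b, k) :: rest, hE, D0, D1, D2, h => by
      have hab := hE (a, b, k) (by simp)
      simp only at hab
      simp only [cellSums] at h
      split at h
      · rename_i h0 h1 h2 s0 s1 s2 hep hcs
        simp only [Option.some.injEq, Prod.mk.injEq] at h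
        obtain ⟨rfl, rfl, rfl⟩ := h
        obtain ⟨r0, r1, r2⟩ := cellSums_sound hB hlogNc hNc rest (fun t ht => hE t (by simp [ht])) hcs
        have hA : FI.mem (Real.log ((Nc : ℝ) - a)) (logsAt logNc Nc a) := mem_logsAt hlogNc (by omega)
        have hLl : FI.mem (Real.log ((b : ℝ) - a)) (RungCert.lg (FI.logTable 16) (b - a)) := by
          have hok : FI.logTableOK 16 = true := by decide
          have := FI.mem_logTable hok (n := b - a) (by omega)
          unfold RungCert.lg
          convert this using 2; push_cast [Nat.cast_sub hab.1.le]; ring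
        obtain ⟨e0, e1, e2⟩ := edgePoint_sound hB hA hLl hab.1 hab.2 hNc hep
        refine ⟨?_, ?_, ?_⟩
        · have := FI.mem_add r0 (FI.mem_mulInt e0 k)
          rw [dsum_cons]; convert this using 1; simp only; ring
        · have := FI.mem_add r1 (FI.mem_mulInt e1 k)
          rw [dsum_cons]; convert this using 1; simp only; ring
        · have := FI.mem_add r2 (FI.mem_mulInt e2 k)
          rw [dsum_cons]; convert this using 1; simp only; ring
      · exact absurd h (by simp)

/-- Soundness of `grossB`: `|D‴(N)| ≤ grossB` on `[N₁, N₂]`. [folklore] -/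
theorem grossB_sound {logN2 : FI} {N1 N2 : ℕ} (hlogN2 : FI.mem (Real.log N2) logN2) (h128 : 128 ≤ N1)
    {N : ℝ} (hN1 : (N1 : ℝ) ≤ N) (hN2 : N ≤ (N2 : ℝ)) :
    ∀ (E : List (ℕ × ℕ × ℤ)), (∀ t ∈ E, t.1 < t.2.1 ∧ t.2.1 ≤ 15) →
      |dsum edgeH3 E N| ≤ (grossB N1 N2 (FI.hiQ logN2) E : ℝ)
  | [], _ => by simp [dsum, grossB]
  | (a, b, k) :: rest, hE => by
      have hab := hE (a, b, k) (by simp)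
      simp only at hab
      have hrest := grossB_sound hlogN2 h128 hN1 hN2 rest (fun t ht => hE t (by simp [ht]))
      have h128' : (128 : ℝ) ≤ N1 := by exact_mod_cast h128
      have hb15 : (b : ℝ) ≤ 15 := by exact_mod_cast hab.2
      have hab' : (a : ℝ) < b := by exact_mod_cast hab.1
      have ha0 : (0 : ℝ) ≤ a := Nat.cast_nonneg a
      have hN1' : (2 * b : ℝ) - a < N1 := by linarith
      have hu : ((b : ℝ) - a) / ((N1 : ℝ) - b) ≤ 1 / 2 := by
        rw [div_le_iff₀ (by linarith)]; linarith
      -- the logarithmic factor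
      have hN2pos : (0 : ℝ) < N2 := by linarith
      have hLl : FI.mem (Real.log ((b : ℝ) - a)) (RungCert.lg (FI.logTable 16) (b - a)) := by
        have hok : FI.logTableOK 16 = true := by decide
        have := FI.mem_logTable hok (n := b - a) (by omega)
        unfold RungCert.lg
        convert this using 2; push_cast [Nat.cast_sub hab.1.le]; ring
      have hL : Real.log (((N2 : ℝ) - a) / ((b : ℝ) - a))
          ≤ ((FI.hiQ logN2 - FI.loQ (RungCert.lg (FI.logTable 16) (b - a)) : ℚ) : ℝ) := by
        push_cast
        rw [Real.log_div (by linarith) (by linarith)]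
        have h1 : Real.log ((N2 : ℝ) - a) ≤ Real.log N2 := Real.log_le_log (by linarith) (by linarith)
        have h2 := FI.le_hiQ hlogN2
        have h3 := FI.loQ_le hLl
        linarith
      have hedge := abs_edgeH3_le hab.1 hN1' hu hN1 hN2 hL
      have hcast : edgeH3Bound a b N1 N2 (((FI.hiQ logN2 - FI.loQ (RungCert.lg (FI.logTable 16) (b - a)) : ℚ) : ℝ))
          = (((edgeH3BoundQ a b N1 N2 (FI.hiQ logN2 - FI.loQ (RungCert.lg (FI.logTable 16) (b - a)))) : ℚ) : ℝ) := by
        simp only [edgeH3Bound, edgeH3BoundQ]; push_cast; ring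
      rw [dsum_cons]
      simp only [grossB]
      push_cast
      have hk : |(k : ℝ) * edgeH3 a b N| ≤ |(k : ℝ)| * (edgeH3BoundQ a b N1 N2
          (FI.hiQ logN2 - FI.loQ (RungCert.lg (FI.logTable 16) (b - a))) : ℝ) := by
        rw [abs_mul, ← hcast]; exact mul_le_mul_of_nonneg_left hedge (abs_nonneg _)
      have hkc : |((k : ℚ) : ℝ)| = |(k : ℝ)| := by push_cast; rfl
      calc |(k : ℝ) * edgeH3 a b N + dsum edgeH3 rest N|
          ≤ |(k : ℝ) * edgeH3 a b N| + |dsum edgeH3 rest N| := abs_add_le _ _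
        _ ≤ _ := by linarith [hk, hrest]

/-- Soundness of `cellCheckWith`. [folklore] -/
theorem cellCheckWith_sound {E : List (ℕ × ℕ × ℤ)} (hE : ∀ t ∈ E, t.1 < t.2.1 ∧ t.2.1 ≤ 15)
    {B logNc logN2 : FI} {N1 Nc N2 : ℕ} (hB : FI.mem zetaScrewSlope B)
    (hlogNc : FI.mem (Real.log Nc) logNc) (hlogN2 : FI.mem (Real.log N2) logN2)
    (h : cellCheckWith B logNc logN2 E N1 Nc N2 = true) {N : ℝ} (hN1 : (N1 : ℝ) ≤ N) (hN2 : N ≤ (N2 : ℝ)) :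
    dsum edgeH E N < 0 := by
  unfold cellCheckWith at h
  dsimp only at h
  generalize hcs : cellSums B (max ((N2 : ℚ) - Nc) ((Nc : ℚ) - N1)) (logsAt logNc Nc) Nc E = ocs at h
  rcases ocs with _ | ⟨D0, D1d, D2dd⟩
  · exact (Bool.false_ne_true h).elim
  · simp only [Bool.and_eq_true, decide_eq_true_eq] at h
    obtain ⟨⟨h128, hc1, hc2⟩, hlt⟩ := h
    obtain ⟨m0, m1, m2⟩ := cellSums_sound hB hlogNc (by omega) E hE hcs
    set Δq : ℚ := max ((N2 : ℚ) - Nc) ((Nc : ℚ) - N1) with hΔq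
    have hEdges : ∀ t ∈ E, t.1 < t.2.1 ∧ 2 * t.2.1 ≤ 30 + t.1 := fun t ht => ⟨(hE t ht).1, by have := (hE t ht).2; omega⟩
    have hTaylor := dsum_taylor_bound hEdges (N1 := (N1 : ℝ)) (Nc := (Nc : ℝ)) (N2 := (N2 : ℝ))
      (B := (grossB N1 N2 (FI.hiQ logN2) E : ℝ)) (Δ := (Δq : ℝ))
      (by exact_mod_cast (show (30 : ℕ) < N1 by omega)) (by exact_mod_cast hc1) (by exact_mod_cast hc2)
      (by rw [hΔq]; push_cast; exact le_max_left _ _) (by rw [hΔq]; push_cast; exact le_max_right _ _)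
      (fun M hM => grossB_sound hlogN2 h128 hM.1 hM.2 E hE) ⟨hN1, hN2⟩
    have hc2' : (Nc : ℝ) ≤ N2 := by exact_mod_cast hc2
    have hΔ0 : (0 : ℝ) ≤ (Δq : ℝ) := by
      rw [hΔq]; push_cast
      exact le_trans (by linarith) (le_max_left _ _)
    have b0 : dsum edgeH E Nc ≤ (FI.hiQ D0 : ℝ) := FI.le_hiQ m0
    have b1 : |dsum edgeH1 E Nc| * (Δq : ℝ) ≤ (FI.absHiQ D1d : ℝ) := by
      have := FI.abs_le_absHiQ m1
      rwa [abs_mul, abs_of_nonneg hΔ0] at this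
    have b2 : max (dsum edgeH2 E Nc) 0 * (Δq : ℝ) ^ 2 / 2 ≤ max (FI.hiQ D2dd : ℝ) 0 / 2 := by
      have h2 := FI.le_hiQ m2
      have e : max (dsum edgeH2 E Nc) 0 * (Δq : ℝ) ^ 2 = max (dsum edgeH2 E Nc * (Δq : ℝ) ^ 2) 0 := by
        rw [max_mul_of_nonneg _ _ (by positivity), zero_mul]
      rw [e]
      have := max_le_max h2 (le_refl (0 : ℝ))
      linarith
    have hlt' : ((FI.hiQ D0 + FI.absHiQ D1d + max (FI.hiQ D2dd) 0 / 2
        + grossB N1 N2 (FI.hiQ logN2) E * Δq ^ 3 / 6 : ℚ) : ℝ) < 0 := by exact_mod_cast hlt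
    push_cast at hlt'
    linarith

/-- Soundness of `logNat`: `log n ∈ logNat n`. [folklore] -/
theorem mem_logNat {n : ℕ} {L : FI} (h : logNat n = some L) : 0 < n ∧ FI.mem (Real.log n) L := by
  cases n with
  | zero => simp [logNat] at h
  | succ m =>
    refine ⟨Nat.succ_pos m, ?_⟩
    unfold logNat at h
    have hpos : (0 : ℝ) < ((m + 1 : ℕ) : ℝ) := by positivity
    have := mem_logPos h (by simpa using FI.mem_ofInt (((m + 1 : ℕ) : ℤ))) hpos
    simpa using this

/-- **Soundness of the cell test**: `cellCheck E N₁ N_c N₂ = true` implies `D(N) < 0` for every real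
`N ∈ [N₁, N₂]` (edges with `a < b ≤ 15`). [folklore] -/
theorem cellCheck_sound {E : List (ℕ × ℕ × ℤ)} (hE : ∀ t ∈ E, t.1 < t.2.1 ∧ t.2.1 ≤ 15) {N1 Nc N2 : ℕ}
    (h : cellCheck E N1 Nc N2 = true) {N : ℝ} (hN1 : (N1 : ℝ) ≤ N) (hN2 : N ≤ (N2 : ℝ)) :
    dsum edgeH E N < 0 := by
  unfold cellCheck at h
  generalize hb : betaFI = ob at h
  generalize hl1 : logNat Nc = ol1 at h
  generalize hl2 : logNat N2 = ol2 at h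
  rcases ob with _ | B
  · exact (Bool.false_ne_true h).elim
  rcases ol1 with _ | logNc
  · exact (Bool.false_ne_true h).elim
  rcases ol2 with _ | logN2
  · exact (Bool.false_ne_true h).elim
  have h' : cellCheckWith B logNc logN2 E N1 Nc N2 = true := h
  have hB := mem_betaFI hb
  obtain ⟨_, hlogNc⟩ := mem_logNat hl1
  obtain ⟨_, hlogN2⟩ := mem_logNat hl2
  exact cellCheckWith_sound hE hB hlogNc hlogN2 h' hN1 hN2


/-! ### Preparations for the last cell -/

/-- `f(λ) = λβ − (λ log λ)/2` is antitone on `[1, ∞)` (`β ≤ 1/2`). [folklore] -/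
theorem fLam_antitone : AntitoneOn (fun x : ℝ => x * zetaScrewSlope - x * Real.log x / 2) (Set.Ici 1) := by
  have hβ := zetaScrewSlope_sub_half_bounds.2
  apply antitoneOn_of_deriv_nonpos (convex_Ici 1)
  · have : ContinuousOn (fun x : ℝ => x * zetaScrewSlope - x * Real.log x / 2) (Set.Ici 1) := by
      apply ContinuousOn.sub (continuousOn_id.mul continuousOn_const)
      exact (Real.continuous_mul_log.continuousOn).div_const 2
    exact this
  · intro x hx
    rw [interior_Ici] at hx
    have hx0 : x ≠ 0 := by have := hx.out; positivity
    exact (((hasDerivAt_id x).mul_const zetaScrewSlope).sub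
      ((Real.hasDerivAt_mul_log hx0).div_const 2)).differentiableAt.differentiableWithinAt
  · intro x hx
    rw [interior_Ici] at hx
    have hx1 : 1 < x := hx
    have hx0 : x ≠ 0 := by positivity
    have hd := ((hasDerivAt_id x).mul_const zetaScrewSlope).sub ((Real.hasDerivAt_mul_log hx0).div_const 2)
    have hderiv : deriv (fun x : ℝ => x * zetaScrewSlope - x * Real.log x / 2) x
        = 1 * zetaScrewSlope - (Real.log x + 1) / 2 := hd.deriv
    rw [hderiv]
    have hlog : 0 ≤ Real.log x := Real.log_nonneg hx1.le
    linarith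

/-- The real value enclosed by `lastEdgeRB`. [folklore] -/
noncomputable def rbVal (a b : ℕ) (k : ℤ) (Ntop : ℕ) : ℝ :=
  let l : ℝ := (b : ℝ) - a
  let lamMax : ℝ := l * Ntop / ((Ntop : ℝ) - b)
  let uMax : ℝ := l / ((Ntop : ℝ) - b)
  if 0 ≤ k then
    (k : ℝ) * ((l * zetaScrewSlope - Real.log l * l / 2)
      + (7 / 8 * lamMax * uMax + lamMax * uMax ^ 2
          * (1 / 288 + 3 * uMax / 128 + uMax ^ 2 / 64000 + 17 * uMax ^ 3 / 72000)))
  else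
    (k : ℝ) * (lamMax * zetaScrewSlope - Real.log lamMax * lamMax / 2)

/-- `rbVal ∈ lastEdgeRB`. [folklore] -/
theorem mem_lastEdgeRB {B logL : FI} {a b : ℕ} {k : ℤ} {Ntop : ℕ} (hB : FI.mem zetaScrewSlope B)
    (hL : FI.mem (Real.log ((b : ℝ) - a)) logL) (hab : a < b) (hb : b < Ntop) :
    FI.mem (rbVal a b k Ntop) (lastEdgeRB B logL a b k Ntop) := by
  have hNt : (b : ℝ) < Ntop := by exact_mod_cast hb
  have hab' : (a : ℝ) < b := by exact_mod_cast hab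
  have hpos : (0 : ℝ) < (b : ℝ) - a := by linarith
  have hx0 : (0 : ℚ) ≤ (b : ℚ) / Ntop := by positivity
  have hx1 : (b : ℚ) / Ntop < 1 := by
    rw [div_lt_one (by exact_mod_cast (lt_of_le_of_lt (Nat.zero_le b) hb))]; exact_mod_cast hb
  obtain ⟨n1, n2⟩ := negLogOneSubQ_spec hx0 hx1 8
  have hNt0 : (0 : ℝ) < Ntop := by linarith [(Nat.cast_nonneg b : (0:ℝ) ≤ b)]
  unfold rbVal lastEdgeRB
  dsimp only
  split_ifs with hk
  · have hl : FI.mem (((b : ℝ) - a)) (FI.ofRat ((b : ℚ) - a)) := by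
      have := FI.mem_ofRat ((b : ℚ) - a); push_cast at this; exact this
    have c := FI.mem_ofRat (7 / 8 * (((b : ℚ) - a) * Ntop / ((Ntop : ℚ) - b)) * (((b : ℚ) - a) / ((Ntop : ℚ) - b))
      + (((b : ℚ) - a) * Ntop / ((Ntop : ℚ) - b)) * (((b : ℚ) - a) / ((Ntop : ℚ) - b)) ^ 2
        * (1 / 288 + 3 * (((b : ℚ) - a) / ((Ntop : ℚ) - b)) / 128 + (((b : ℚ) - a) / ((Ntop : ℚ) - b)) ^ 2 / 64000
          + 17 * (((b : ℚ) - a) / ((Ntop : ℚ) - b)) ^ 3 / 72000))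
    have := FI.mem_mulInt (FI.mem_add (FI.mem_sub (FI.mem_mul hB hl)
      (FI.mem_divNat (FI.mem_mul hL hl) (n := 2) (by norm_num))) c) k
    convert this using 1; push_cast; ring
  · have hloglam : FI.mem (Real.log (((b : ℝ) - a) * Ntop / ((Ntop : ℝ) - b)))
        (logL.add (FI.ofRatRat (negLogOneSubQ ((b : ℚ) / Ntop) 8).1 (negLogOneSubQ ((b : ℚ) / Ntop) 8).2)) := by
      have hcast : ((1 : ℝ) - (((b : ℚ) / Ntop : ℚ) : ℝ)) = ((Ntop : ℝ) - b) / Ntop := by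
        push_cast; field_simp
      rw [hcast] at n1 n2
      have hm := FI.mem_ofRatRat n1 n2
      have e : Real.log (((b : ℝ) - a) * Ntop / ((Ntop : ℝ) - b))
          = Real.log ((b : ℝ) - a) + (-Real.log (((Ntop : ℝ) - b) / Ntop)) := by
        rw [Real.log_div (by positivity) (by linarith), Real.log_mul hpos.ne' hNt0.ne',
          Real.log_div (by linarith) hNt0.ne']
        ring
      rw [e]; exact FI.mem_add hL hm
    have hlm : FI.mem (((b : ℝ) - a) * Ntop / ((Ntop : ℝ) - b)) (FI.ofRat (((b : ℚ) - a) * Ntop / ((Ntop : ℚ) - b))) := by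
      have := FI.mem_ofRat (((b : ℚ) - a) * Ntop / ((Ntop : ℚ) - b)); push_cast at this; exact this
    have := FI.mem_mulInt (FI.mem_sub (FI.mem_mul hB hlm)
      (FI.mem_divNat (FI.mem_mul hloglam hlm) (n := 2) (by norm_num))) k
    convert this using 1; push_cast; ring

/-- `RL(u) ≥ 0` on `[0, 1/2]`. [folklore] -/
theorem RL_nonneg {u : ℝ} (h0 : 0 ≤ u) (h1 : u ≤ 1 / 2) :
    0 ≤ u ^ 3 / 288 + u ^ 4 / 48 - u ^ 5 / 16000 - u ^ 6 / 4800 := by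
  have h3 : 0 ≤ u ^ 3 := by positivity
  have hu2 : u ^ 2 ≤ 1 / 4 := by nlinarith
  have hu3 : u ^ 3 ≤ 1 / 8 := by nlinarith
  have e : u ^ 3 / 288 + u ^ 4 / 48 - u ^ 5 / 16000 - u ^ 6 / 4800
      = u ^ 3 * (1 / 288 + u / 48 - u ^ 2 / 16000 - u ^ 3 / 4800) := by ring
  rw [e]
  apply mul_nonneg h3
  nlinarith

/-- Decomposition `N·main(u) = (log N)/2·λ + f(λ) + (7/8)λu` with `λ = N u`. [folklore] -/
theorem main_decomp {N u : ℝ} (hN : 0 < N) (hu : 0 < u) :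
    N * zetaScrewMain u = Real.log N / 2 * (N * u)
      + ((N * u) * zetaScrewSlope - (N * u) * Real.log (N * u) / 2) + 7 / 8 * (N * u) * u := by
  unfold zetaScrewMain
  rw [Real.log_mul hN.ne' hu.ne']
  ring

end Summit.RiemannHypothesis.RiemannHypothesis.Theorems.IntegerScrew.TopBlockNeg

end
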